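import Mathlib.MeasureTheory.Measure.Hausdorff
import Literature.Analysis.FluidPDE.HardSphereDynamics
import HarnessLib

/-!
# The Boltzmann–Sinai ergodic hypothesis for hard balls on the torus (Simányi)

Trunk `Literature/MathematicalPhysics/KineticTheory`; fact item `wi-05003` (input/benchmark for the
cruxes GibbsErgodicity, stmt-AtomisticToContinuum-0779, and UniformLocalMixing, stmt-0830).

## The source statement

Simányi 2009 (Invent. Math. 177, = arXiv:math/0605358), §1 **Theorem** (p. 3): *for any integers
`N ≥ 2`, `ν ≥ 2` and every `(N+1)`-tuple `(m₁,…,m_N; r)` of external parameters the standard hard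
ball system `(M, {Sᵗ}, μ)` is (fully hyperbolic and) ergodic, provided the Chernov–Sinai Ansatz
holds for all such systems*; Simányi 2013 (Nonlinearity 26, = arXiv:1205.0061), abstract and §4
"Proof of the Boltzmann–Sinai Ergodic Hypothesis for all hard ball systems" (p. 18): the Ansatz is
proved (Theorem 2.1, non-coincidence) and hence *every* such system is ergodic (indeed Bernoulli);
§4 is written for equal masses. The standing assumption of both papers (2009 §2 p. 6, 2013 §1) is
that the radius is "not too big", i.e. **the interior of the configuration space is connected**
(2009, Remark 1.1).

The *standard hard ball system* (2009, §2): `N` balls of radius `r` on `𝕋^ν = ℝ^ν/ℤ^ν`, elastic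
collisions, total momentum `∑ mᵢvᵢ = 0`, kinetic energy fixed, and the configuration space
**factorised by the simultaneous translations** `(q₁,…,q_N) ∼ (q₁+a,…,q_N+a)`, `a ∈ 𝕋^ν`; `μ` is
the (normalised) Liouville measure `dq dv` on this phase space `M`.

## The rendering over `Kinetic.HardSphereFlow (Torus.geometry d) ε N`

The tree's hard-sphere vocabulary (`HardSpherePhaseSpace`, `HardSphereDynamics`) has **unit masses**
(the reflection law `reflectVel` is the equal-mass law) and spheres of **diameter** `ε` (`= 2r`) on
Mathlib's `UnitAddTorus d` with the minimal-image distance; the phase space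
`Config N d (UnitAddTorus d)` is *not* reduced. Simányi's `M` at energy `e` is the quotient of the
zero-momentum energy surface `Y_e = {z ∈ D_ε^N | ½∑|vᵢ|² = e, ∑vᵢ = 0}` by the diagonal torus
action `translateAll a : (qᵢ, vᵢ) ↦ (qᵢ + a, vᵢ)`, and `μ` is the image of the surface measure of
`Y_e`. Hence "`(M, Sᵗ, μ)` is ergodic" reads, upstairs: **every measurable subset of phase space
that is invariant under all `translateAll a` and under all `Φ_t` is null or conull for the surface
measure of `Y_e`** (`simanyi_hardBall_ergodic`). We use the Hausdorff measure
`μH[d(2N-1)-1]` restricted to `Y_e` (`shellMeasure`; only its null sets matter, and these do not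
depend on the (sup- vs. Euclidean) product metric: bi-Lipschitz changes of metric change `μH` by
bounded factors). Because a `HardSphereFlow` is only defined Liouville-a.e. and `Y_e` is
Liouville-null, the fact carries the hypothesis that the good set of `Φ` is `shellMeasure`-conull on
`Y_e`; on such a `Φ` the good orbits are hard-sphere trajectories (`HardSphereFlow.isTrajectory`),
i.e. Simányi's billiard orbits. Energy `e > 0` arbitrary (Simányi normalises `2e = 1`; the flows at
different energies are constant time-changes of each other, `v ↦ λv`, `t ↦ t/λ`, with the same
invariant sets). Coverage recorded in the docstring: `N ≥ 2`, `dim ≥ 2`, unit masses, any diameter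
`0 < ε < 1/2` with connected configuration-space interior — in particular equal masses at small
packing fraction, the case the routes need.

## Definitions (namespace `Literature.Kinetic`, torus geometry)

* `translateAll a z` — the diagonal translation symmetry; `configPositionSum z = ∑ qᵢ ∈ 𝕋^d`, the
  extra first integral of the zero-momentum torus dynamics (Sinai's "centre of mass on a lattice").
* `torusConfigInterior d N ε` — positions with all pairwise minimal-image distances `> ε` (the
  interior of the configuration space).
* `zeroMomentumEnergyShell N ε e = Y_e`, `shellMeasure N ε e = μH[d(2N-1)-1]|_{Y_e}`.

## Mathlib search

`PreErgodic`/`Ergodic`/`QuasiErgodic` (single map, strict invariance `f ⁻¹' s = s` — we use the same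
shape for the family `{Φ_t} ∪ {translateAll a}`), `ErgodicSMul` (group actions; the flow is not an
action off the good set), `Measure.hausdorffMeasure` `μH[·]` (used), `UnitAddTorus`, `AddCircle`
(used); no billiards / hard balls in Mathlib (`billiard`, `hardBall`: nothing).

## References

* N. Simányi, *Conditional proof of the Boltzmann–Sinai ergodic hypothesis*, Invent. Math. 177
  (2009) 381–413, arXiv:math/0605358: §1 Theorem, Remarks 1.1–1.3; §2 (the standard hard ball
  system).
* N. Simányi, *Singularities and non-hyperbolic manifolds do not coincide*, Nonlinearity 26 (2013)
  1703–1717, arXiv:1205.0061: abstract, Theorem 2.1, §4.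
* Ya. G. Sinai, *Dynamical systems with elastic reflections*, Russ. Math. Surv. 25 (1970).
-/

noncomputable section

open MeasureTheory Set Filter Topology
open scoped ENNReal

namespace Literature.MathematicalPhysics.KineticTheory

universe u

variable {d : Type*} [Fintype d] {N : ℕ}

/-! ### The diagonal translation symmetry and the position-sum integral -/

/-- The diagonal translation of all positions by `a ∈ 𝕋^d`: `(qᵢ, vᵢ)ᵢ ↦ (qᵢ + a, vᵢ)ᵢ` — the
symmetry by which Simányi factorises the configuration space (Simányi 2009, §2:
`(q₁,…,q_N) ∼ (q₁+a,…,q_N+a)`). [cite: Simanyi2009, §2] -/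
def translateAll (a : UnitAddTorus d) (z : Literature.Analysis.FluidPDE.Config N d (UnitAddTorus d)) :
    Literature.Analysis.FluidPDE.Config N d (UnitAddTorus d) :=
  fun i => ((z i).1 + a, (z i).2)

omit [Fintype d] in
/-- Unfolding lemma. [folklore] -/
@[simp] theorem translateAll_apply (a : UnitAddTorus d) (z : Literature.Analysis.FluidPDE.Config N d (UnitAddTorus d)) (i : Fin N) :
    translateAll a z i = ((z i).1 + a, (z i).2) := rfl

omit [Fintype d] in
/-- Translating by `0` is the identity. [folklore] -/
@[simp] theorem translateAll_zero (z : Literature.Analysis.FluidPDE.Config N d (UnitAddTorus d)) : translateAll 0 z = z := by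
  funext i; simp

omit [Fintype d] in
/-- The diagonal translations form an action of `𝕋^d`. [folklore] -/
theorem translateAll_add (a b : UnitAddTorus d) (z : Literature.Analysis.FluidPDE.Config N d (UnitAddTorus d)) :
    translateAll (a + b) z = translateAll a (translateAll b z) := by
  funext i; simp [add_comm a b, add_assoc]

/-- Diagonal translations do not change velocities, hence preserve the kinetic energy. [folklore] -/
@[simp] theorem configEnergy_translateAll (a : UnitAddTorus d) (z : Literature.Analysis.FluidPDE.Config N d (UnitAddTorus d)) :
    Literature.Analysis.FluidPDE.configEnergy (translateAll a z) = Literature.Analysis.FluidPDE.configEnergy z := rfl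

omit [Fintype d] in
/-- Diagonal translations preserve the total momentum. [folklore] -/
@[simp] theorem configMomentum_translateAll (a : UnitAddTorus d)
    (z : Literature.Analysis.FluidPDE.Config N d (UnitAddTorus d)) : Literature.Analysis.FluidPDE.configMomentum (translateAll a z) = Literature.Analysis.FluidPDE.configMomentum z := rfl

/-- Diagonal translations preserve all minimal-image separation vectors, hence the hard-sphere
domain. [folklore] -/
@[simp] theorem translateAll_mem_hardSphereDomain_iff (a : UnitAddTorus d) (ε : ℝ)
    (z : Literature.Analysis.FluidPDE.Config N d (UnitAddTorus d)) :
    translateAll a z ∈ Literature.Analysis.FluidPDE.hardSphereDomain (Literature.Analysis.FluidPDE.Torus.geometry d) N ε ↔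
      z ∈ Literature.Analysis.FluidPDE.hardSphereDomain (Literature.Analysis.FluidPDE.Torus.geometry d) N ε := by
  simp [Literature.Analysis.FluidPDE.mem_hardSphereDomain, add_sub_add_right_eq_sub]

/-- Free flight commutes with the diagonal translations. [folklore] -/
theorem freeFlight_translateAll (t : ℝ) (a : UnitAddTorus d) (z : Literature.Analysis.FluidPDE.Config N d (UnitAddTorus d)) :
    Literature.Analysis.FluidPDE.freeFlight (Literature.Analysis.FluidPDE.Torus.geometry d) t (translateAll a z) =
      translateAll a (Literature.Analysis.FluidPDE.freeFlight (Literature.Analysis.FluidPDE.Torus.geometry d) t z) := by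
  funext i
  simp [add_right_comm]

omit [Fintype d] in
/-- The position sum `∑ᵢ qᵢ ∈ 𝕋^d` — a first integral of the zero-momentum torus dynamics
(`d/dt ∑ qᵢ = ∑ vᵢ = 0`, collisions do not move positions); fixing it is Sinai's "restriction of the
centre of mass to a discrete lattice" (Simányi 2009, §1). [cite: Simanyi2009, §1] -/
def configPositionSum (z : Literature.Analysis.FluidPDE.Config N d (UnitAddTorus d)) : UnitAddTorus d := ∑ i, (z i).1

omit [Fintype d] in
/-- The position sum is shifted by `N • a` under the diagonal translation by `a`. [folklore] -/
theorem configPositionSum_translateAll (a : UnitAddTorus d) (z : Literature.Analysis.FluidPDE.Config N d (UnitAddTorus d)) :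
    configPositionSum (translateAll a z) = configPositionSum z + N • a := by
  simp [configPositionSum, Finset.sum_add_distrib]

/-! ### The configuration space, the zero-momentum energy surface and its surface measure -/

/-- The interior of the `N`-ball configuration space on `𝕋^d` for spheres of diameter `ε`:
position `N`-tuples all of whose pairwise minimal-image distances exceed `ε` (Simányi 2009, §2:
`𝕋^{νN}` minus the closed cylinders `dist(qᵢ, qⱼ) ≤ 2r`, before factorisation). Its connectedness is
the standing "radius not too big" hypothesis of the theorem. [cite: Simanyi2009, §2] -/
def torusConfigInterior (d : Type*) [Fintype d] (N : ℕ) (ε : ℝ) : Set (Fin N → UnitAddTorus d) :=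
  {x | ∀ i j, i ≠ j → ε < Literature.Analysis.FluidPDE.Torus.euclidDist (x i) (x j)}

/-- Membership in the configuration-space interior. [folklore] -/
theorem mem_torusConfigInterior {ε : ℝ} {x : Fin N → UnitAddTorus d} :
    x ∈ torusConfigInterior d N ε ↔ ∀ i j, i ≠ j → ε < Literature.Analysis.FluidPDE.Torus.euclidDist (x i) (x j) := Iff.rfl

/-- A configuration whose positions lie in the interior lies in the (closed) hard-sphere domain. [folklore] -/
theorem mem_hardSphereDomain_of_pos_mem_torusConfigInterior {ε : ℝ} {z : Literature.Analysis.FluidPDE.Config N d (UnitAddTorus d)}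
    (h : (fun i => (z i).1) ∈ torusConfigInterior d N ε) :
    z ∈ Literature.Analysis.FluidPDE.hardSphereDomain (Literature.Analysis.FluidPDE.Torus.geometry d) N ε := by
  intro i j hij
  rw [Literature.Analysis.FluidPDE.Torus.norm_geometry_sepVec]
  exact (h i j hij).le

/-- The phase space `(𝕋^d × ℝ^d)^N` is a Borel space (Mathlib `Pi.borelSpace`, `Prod.borelSpace`,
`QuotientAddGroup.borelSpace`; the instance search only needs a larger size bound). [folklore] -/
instance instBorelSpaceConfigTorus : BorelSpace (Literature.Analysis.FluidPDE.Config N d (UnitAddTorus d)) := by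
  set_option synthInstance.maxSize 512 in exact inferInstance

/-- The kinetic energy is a continuous function on phase space. [folklore] -/
theorem continuous_configEnergy : Continuous (Literature.Analysis.FluidPDE.configEnergy : Literature.Analysis.FluidPDE.Config N d (UnitAddTorus d) → ℝ) := by
  unfold Literature.Analysis.FluidPDE.configEnergy
  fun_prop

/-- The total momentum is a continuous function on phase space. [folklore] -/
theorem continuous_configMomentum :
    Continuous (Literature.Analysis.FluidPDE.configMomentum : Literature.Analysis.FluidPDE.Config N d (UnitAddTorus d) → EuclideanSpace ℝ d) := by
  unfold Literature.Analysis.FluidPDE.configMomentum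
  fun_prop

/-- The **zero-momentum energy surface** `Y_e = {z ∈ D_ε^N | ½∑|vᵢ|² = e, ∑ vᵢ = 0}` of the
`N`-sphere torus system (Simányi 2009, §2: energy fixed, "standard reduction `I = 0`"; its quotient
by `translateAll` is Simányi's phase space `M`). [cite: Simanyi2009, §2] -/
def zeroMomentumEnergyShell (N : ℕ) (ε e : ℝ) : Set (Literature.Analysis.FluidPDE.Config N d (UnitAddTorus d)) :=
  Literature.Analysis.FluidPDE.hardSphereDomain (Literature.Analysis.FluidPDE.Torus.geometry d) N ε ∩ {z | Literature.Analysis.FluidPDE.configEnergy z = e ∧ Literature.Analysis.FluidPDE.configMomentum z = 0}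

/-- Membership in the zero-momentum energy surface. [folklore] -/
theorem mem_zeroMomentumEnergyShell {ε e : ℝ} {z : Literature.Analysis.FluidPDE.Config N d (UnitAddTorus d)} :
    z ∈ zeroMomentumEnergyShell N ε e ↔
      z ∈ Literature.Analysis.FluidPDE.hardSphereDomain (Literature.Analysis.FluidPDE.Torus.geometry d) N ε ∧ Literature.Analysis.FluidPDE.configEnergy z = e ∧ Literature.Analysis.FluidPDE.configMomentum z = 0 :=
  Iff.rfl

/-- The zero-momentum energy surface is a Borel set. [folklore] -/
theorem measurableSet_zeroMomentumEnergyShell (N : ℕ) (ε e : ℝ) :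
    MeasurableSet (zeroMomentumEnergyShell (d := d) N ε e) := by
  refine (Literature.Analysis.FluidPDE.measurableSet_hardSphereDomain _ Literature.Analysis.FluidPDE.Torus.measurable_geometry_sepVec N ε).inter ?_
  exact (measurableSet_eq_fun continuous_configEnergy.measurable measurable_const).inter
    (measurableSet_eq_fun continuous_configMomentum.measurable measurable_const)

/-- The zero-momentum energy surface is invariant under the diagonal translations. [folklore] -/
@[simp] theorem translateAll_mem_zeroMomentumEnergyShell_iff (a : UnitAddTorus d) {ε e : ℝ}
    (z : Literature.Analysis.FluidPDE.Config N d (UnitAddTorus d)) :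
    translateAll a z ∈ zeroMomentumEnergyShell N ε e ↔ z ∈ zeroMomentumEnergyShell N ε e := by
  simp [mem_zeroMomentumEnergyShell]

/-- Free flight preserves the energy and momentum constraints of the surface (it may leave the
hard-sphere domain). [folklore] -/
theorem freeFlight_mem_zeroMomentumEnergyShell_iff (t : ℝ) {ε e : ℝ}
    (z : Literature.Analysis.FluidPDE.Config N d (UnitAddTorus d)) :
    Literature.Analysis.FluidPDE.freeFlight (Literature.Analysis.FluidPDE.Torus.geometry d) t z ∈ zeroMomentumEnergyShell N ε e ↔
      Literature.Analysis.FluidPDE.freeFlight (Literature.Analysis.FluidPDE.Torus.geometry d) t z ∈ Literature.Analysis.FluidPDE.hardSphereDomain (Literature.Analysis.FluidPDE.Torus.geometry d) N ε ∧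
        Literature.Analysis.FluidPDE.configEnergy z = e ∧ Literature.Analysis.FluidPDE.configMomentum z = 0 := by
  simp [mem_zeroMomentumEnergyShell]

/-- The dimension `d(2N-1) - 1 = 2dN - d - 1` of the zero-momentum energy surface (`2dN` phase-space
dimensions, minus `1` energy and `d` momentum constraints; Simányi's `dim M = 2d(N-1) - 1` after the
further quotient by the `d`-dimensional translations). [folklore] -/
def shellDim (d : Type*) [Fintype d] (N : ℕ) : ℝ := Fintype.card d * (2 * N - 1) - 1

/-- The **surface measure of the zero-momentum energy surface**: the Hausdorff measure of dimension
`shellDim d N` restricted to `Y_e`. Only its null sets are used (ergodicity); these agree with those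
of the Liouville surface element `δ(E - e) δ(P) dq dv`, whose image on `M = Y_e/𝕋^d` is Simányi's `μ`
(2009, §2: `dμ = const · dq · dv`). [cite: Simanyi2009, §2] -/
def shellMeasure (N : ℕ) (ε e : ℝ) : Measure (Literature.Analysis.FluidPDE.Config N d (UnitAddTorus d)) :=
  (μH[shellDim d N]).restrict (zeroMomentumEnergyShell (d := d) N ε e)

/-- The surface measure lives on the surface. [folklore] -/
theorem shellMeasure_compl_shell (N : ℕ) (ε e : ℝ) :
    shellMeasure (d := d) N ε e (zeroMomentumEnergyShell N ε e)ᶜ = 0 := by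
  rw [shellMeasure, Measure.restrict_apply (measurableSet_zeroMomentumEnergyShell N ε e).compl,
    compl_inter_self, measure_empty]

/-! ### The named fact -/

/-- **The Boltzmann–Sinai ergodic hypothesis (Simányi 2009 + 2013), unit masses.** Let `d ≥ 2`,
`N ≥ 2`, `0 < ε < 1/2`, and assume the interior of the configuration space of `N` spheres of
diameter `ε` on `𝕋^d` is connected ("radius not too big"). Let `Φ` be a hard-sphere flow on
`(𝕋^d × ℝ^d)^N` and `e > 0` an energy such that `Φ` is defined (good) at `shellMeasure`-almost every
point of the zero-momentum energy surface `Y_e` (there its orbits are the billiard orbits of the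
standard hard ball system). Then the system is **ergodic on `Y_e` modulo translations**: every
measurable set `A` invariant under all diagonal translations `translateAll a` (i.e. descending to
the factorised phase space) and `shellMeasure`-a.e. invariant under every `Φ_t` is
`shellMeasure`-null or conull — i.e. Simányi's `(M, Sᵗ, μ) = (Y_e/𝕋^d, Φ, surface measure)` is
ergodic (invariant-mod-0 sets of the measurable flow are trivial). Source: Simányi 2009, §1 Theorem (every `N ≥ 2`, `ν ≥ 2`, every `(m₁,…,m_N; r)` with
connected interior, conditional on the Chernov–Sinai Ansatz) with Simányi 2013, Thm 2.1 and §4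
(the Ansatz holds; all such systems are ergodic, indeed Bernoulli). Rendered for the tree's
equal-mass reflection law; masses `≠ 1` are not expressible here. Nothing asserted.
[cite: Simanyi2013, §4 with Thm 2.1; Simanyi2009, §1 Theorem] -/
def simanyi_hardBall_ergodic : Prop :=
  ∀ {d : Type u} [Fintype d] {N : ℕ} {ε : ℝ} (Φ : Literature.Analysis.FluidPDE.HardSphereFlow (Literature.Analysis.FluidPDE.Torus.geometry d) ε N),
    2 ≤ Fintype.card d → 2 ≤ N → 0 < ε → ε < 2⁻¹ →
    IsConnected (torusConfigInterior d N ε) →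
    ∀ {e : ℝ}, 0 < e → shellMeasure N ε e Φ.goodᶜ = 0 →
    ∀ ⦃A : Set (Literature.Analysis.FluidPDE.Config N d (UnitAddTorus d))⦄, MeasurableSet A →
      (∀ a : UnitAddTorus d, translateAll a ⁻¹' A = A) →
      (∀ t : ℝ, Φ.flow t ⁻¹' A =ᵐ[shellMeasure N ε e] A) →
      shellMeasure N ε e A = 0 ∨ shellMeasure N ε e Aᶜ = 0

/-- Reformulation of the conclusion as Mathlib-style a.e.-constancy (`Filter.EventuallyConst`, the
form used by `PreErgodic.aeconst_set`): an invariant set is a.e. empty or a.e. everything for the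
surface measure. PROVED from the named fact. [cite: Simanyi2013, §4] -/
theorem simanyi_hardBall_ergodic.eventuallyConst (h : simanyi_hardBall_ergodic.{u})
    {d : Type u} [Fintype d] {N : ℕ} {ε : ℝ} (Φ : Literature.Analysis.FluidPDE.HardSphereFlow (Literature.Analysis.FluidPDE.Torus.geometry d) ε N)
    (hd : 2 ≤ Fintype.card d) (hN : 2 ≤ N) (hε : 0 < ε) (hε' : ε < 2⁻¹)
    (hconn : IsConnected (torusConfigInterior d N ε)) {e : ℝ} (he : 0 < e)
    (hgood : shellMeasure N ε e Φ.goodᶜ = 0) {A : Set (Literature.Analysis.FluidPDE.Config N d (UnitAddTorus d))}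
    (hA : MeasurableSet A) (hT : ∀ a : UnitAddTorus d, translateAll a ⁻¹' A = A)
    (hΦ : ∀ t : ℝ, Φ.flow t ⁻¹' A =ᵐ[shellMeasure N ε e] A) :
    EventuallyConst A (ae (shellMeasure N ε e)) := by
  rw [eventuallyConst_set]
  rcases h Φ hd hN hε hε' hconn he hgood hA hT hΦ with h0 | h1
  · exact Or.inr (measure_eq_zero_iff_ae_notMem.1 h0)
  · exact Or.inl ((measure_eq_zero_iff_ae_notMem.1 h1).mono fun x hx => Set.notMem_compl_iff.1 hx)

/-- The strictly-invariant special case (Mathlib's `PreErgodic` shape `f ⁻¹' s = s` for every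
`Φ_t` and every `translateAll a`). PROVED from the named fact. [cite: Simanyi2013, §4] -/
theorem simanyi_hardBall_ergodic.of_preimage_eq (h : simanyi_hardBall_ergodic.{u})
    {d : Type u} [Fintype d] {N : ℕ} {ε : ℝ} (Φ : Literature.Analysis.FluidPDE.HardSphereFlow (Literature.Analysis.FluidPDE.Torus.geometry d) ε N)
    (hd : 2 ≤ Fintype.card d) (hN : 2 ≤ N) (hε : 0 < ε) (hε' : ε < 2⁻¹)
    (hconn : IsConnected (torusConfigInterior d N ε)) {e : ℝ} (he : 0 < e)
    (hgood : shellMeasure N ε e Φ.goodᶜ = 0) {A : Set (Literature.Analysis.FluidPDE.Config N d (UnitAddTorus d))}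
    (hA : MeasurableSet A) (hT : ∀ a : UnitAddTorus d, translateAll a ⁻¹' A = A)
    (hΦ : ∀ t : ℝ, Φ.flow t ⁻¹' A = A) :
    shellMeasure N ε e A = 0 ∨ shellMeasure N ε e Aᶜ = 0 :=
  h Φ hd hN hε hε' hconn he hgood hA hT fun t => (hΦ t).symm ▸ EventuallyEq.rfl

end Literature.MathematicalPhysics.KineticTheory

end
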